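import Summits.AtomisticToContinuum.BoseEinsteinCondensation.Theses.BECRieszReverseHolder
import Summits.AtomisticToContinuum.BoseEinsteinCondensation.Theorems.BECRieszReverseHolderMicroscaleFlatnessStubBadMassLeSliceKinetic
import Summits.AtomisticToContinuum.BoseEinsteinCondensation.Theorems.BECRieszReverseHolderMicroscaleFlatnessStubSliceKineticLeEnergy
import Summits.AtomisticToContinuum.BoseEinsteinCondensation.Theorems.BECRieszReverseHolderMicroscaleFlatnessStubGroundStateEnergyLinear
import HarnessLib

/-!
# Route `BECRieszReverseHolder` — crux `MicroscaleFlatness` (stmt-AtomisticToContinuum-12842) PROVED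

Closes stmt-AtomisticToContinuum-12842: the exact route declaration
`Summit.AtomisticToContinuum.BoseEinsteinCondensation.Theses.BECRieszReverseHolder.MicroscaleFlatness`
(line `birth` = registered skeleton `Cruxes/MicroscaleFlatness/Lines/birth.lean`, whose composition
`MicroscaleFlatness_of` is reproduced here with its three hypotheses discharged by the landed stubs):

* `MicroscaleFlatness.stub_badMass_le_sliceKinetic` — Poincaré–Wirtinger kinetic localisation on
  bad cubes: bad mass `≤ C (L/m)²/(1-c₀) · ∫dX∫dy |∇₀Ψ(y,X)|²` (`C = 1/π²`, sharp Neumann gap of the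
  cube, tree `local_poincare_cellShift`);
* `MicroscaleFlatness.stub_sliceKinetic_le_energy` — Bose symmetry: `(n+1) ∫dX∫dy |∇₀Ψ|² ≤ ⟨Ψ,HΨ⟩`;
* `MicroscaleFlatness.stub_groundStateEnergy_linear` — Ruelle's bound `E₀(N, L_N) ≤ E N` at small
  density (tree `limsup_lt_top_of_small`, [Ruelle1969, §3.5.11]).

Assembly: `c₀ = θ = 1/2`, `δ = 1`, `ℓ = 1/(4(C+1)(E+1))`; eventually `E₀ ≤ E(n+1)` and
`L = sideLength ρ (n+1) ≥ 2ℓ`, so `m = ⌊L/ℓ⌋₊ ≥ 1`, `L/m ≤ 2ℓ`, and the expected bad mass of a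
non-negative `δ`-near-minimiser is `≤ 2C(L/m)²(E+1) ≤ 8Cℓ²(E+1) ≤ 1/2`. Positivity of `Ψ` is not used.

## References

* [LSSY2005] E. H. Lieb, R. Seiringer, J. P. Solovej, J. Yngvason, *The Mathematics of the Bose Gas
  and its Condensation* (2005), Ch. 5 (5.15)–(5.17); §1.2.
* [Ruelle1969] D. Ruelle, *Statistical Mechanics: Rigorous Results* (1969), §3.5.11.
-/

namespace Summit.AtomisticToContinuum.BoseEinsteinCondensation.Theorems

open scoped BigOperators Topology MeasureTheory ENNReal
open Filter Set Function MeasureTheory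

/-- **`MicroscaleFlatness` holds** (stmt-AtomisticToContinuum-12842, route `BECRieszReverseHolder`):
for a repulsive finite-range `v` there is `ρ₀ > 0` such that for every `0 < ρ < ρ₀` there are
`ℓ > 0`, `c₀ > 0`, `θ < 1` with: for all large `N = n+1` there is `δ > 0` such that for every
non-negative `δ`-near-minimiser `Ψ` the environment-averaged slice mass carried by the bad cubes
(resolution `ℓ`, Cauchy–Schwarz deficit test at level `c₀`) is at most `θ`. Proof: kinetic
localisation (the three stubs of line `birth`) with `c₀ = θ = 1/2`, `δ = 1`,
`ℓ = 1/(4(C+1)(E+1))`. [cite: LSSY2005, Ch. 5 (5.15)–(5.17)] -/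
theorem microscaleFlatness_proof :
    Summit.AtomisticToContinuum.BoseEinsteinCondensation.Theses.BECRieszReverseHolder.MicroscaleFlatness := by
  intro v hv
  obtain ⟨C, hC, hbad⟩ := MicroscaleFlatness.stub_badMass_le_sliceKinetic
  obtain ⟨ρ₀, hρ₀, hρ⟩ := MicroscaleFlatness.stub_groundStateEnergy_linear v hv
  refine ⟨ρ₀, hρ₀, fun ρ hρpos hρlt => ?_⟩
  obtain ⟨E, hE, hev⟩ := hρ ρ hρpos hρlt
  -- the resolution `ℓ = 1/(4(C+1)(E+1))`
  obtain ⟨ℓ, hℓ, hu⟩ : ∃ ℓ : ℝ, 0 < ℓ ∧ ℓ * (4 * (C + 1) * (E + 1)) = 1 :=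
    ⟨1 / (4 * (C + 1) * (E + 1)), by positivity, by
      rw [one_div]; exact inv_mul_cancel₀ (by positivity)⟩
  refine ⟨ℓ, 1 / 2, 1 / 2, hℓ, by norm_num, by norm_num, ?_⟩
  -- `L_N → ∞`
  have hLt : Tendsto (fun n : ℕ =>
      Literature.MathematicalPhysics.QuantumManyBody.BoseGas.sideLength ρ (n + 1)) atTop atTop := by
    unfold Literature.MathematicalPhysics.QuantumManyBody.BoseGas.sideLength
    exact (tendsto_rpow_atTop (by norm_num : (0 : ℝ) < 1 / 3)).comp
      ((tendsto_natCast_atTop_atTop.comp (tendsto_add_atTop_nat 1)).atTop_div_const hρpos)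
  filter_upwards [hev, hLt.eventually_ge_atTop (2 * ℓ)] with n hEn hLn
  refine ⟨1, one_pos, fun Ψ hΨ _hpos => ?_⟩
  intro L m
  -- geometry of the partition: `m ≥ 1` and `L/m ≤ 2ℓ`
  have hL2 : 2 * ℓ ≤ L := hLn
  have hLpos : 0 < L := by linarith
  have hx : (1 : ℝ) ≤ L / ℓ := by rw [le_div_iff₀ hℓ]; linarith
  have hmpos : 0 < m := Nat.floor_pos.mpr hx
  have hmR : (0 : ℝ) < m := by exact_mod_cast hmpos
  have hm1 : L / ℓ < (m : ℝ) + 1 := Nat.lt_floor_add_one _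
  have hsm : L / m ≤ 2 * ℓ := by
    rw [div_le_iff₀ hmR]
    have h' : L < ((m : ℝ) + 1) * ℓ := by rwa [div_lt_iff₀ hℓ] at hm1
    nlinarith
  -- energy bookkeeping: `K ≤ E + 1`
  have hN0 : ((n + 1 : ℕ) : ENNReal) ≠ 0 := by exact_mod_cast Nat.succ_ne_zero n
  have hNtop : ((n + 1 : ℕ) : ENNReal) ≠ ⊤ := ENNReal.natCast_ne_top (n + 1)
  have h1N : (1 : ENNReal) ≤ ((n + 1 : ℕ) : ENNReal) := by exact_mod_cast Nat.le_add_left 1 n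
  have hKle : (∫⁻ X : Fin n → EuclideanSpace ℝ (Fin 3), ∫⁻ y : EuclideanSpace ℝ (Fin 3),
      Literature.MathematicalPhysics.QuantumManyBody.BoseGas.partialGradSq 0 Ψ.ψ (Matrix.vecCons y X)) ≤
        ENNReal.ofReal (E + 1) := by
    have hA : ((n + 1 : ℕ) : ENNReal) *
        (∫⁻ X : Fin n → EuclideanSpace ℝ (Fin 3), ∫⁻ y : EuclideanSpace ℝ (Fin 3),
          Literature.MathematicalPhysics.QuantumManyBody.BoseGas.partialGradSq 0 Ψ.ψ (Matrix.vecCons y X)) ≤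
        ENNReal.ofReal E * ((n + 1 : ℕ) : ENNReal) + 1 :=
      (MicroscaleFlatness.stub_sliceKinetic_le_energy v n L Ψ).trans (hΨ.trans (add_le_add_left hEn 1))
    have hB : ENNReal.ofReal E * ((n + 1 : ℕ) : ENNReal) + 1 ≤
        ENNReal.ofReal (E + 1) * ((n + 1 : ℕ) : ENNReal) := by
      rw [ENNReal.ofReal_add hE.le zero_le_one, ENNReal.ofReal_one, add_mul, one_mul]
      exact add_le_add_right h1N _
    have hC' := hA.trans hB
    rw [mul_comm (ENNReal.ofReal (E + 1))] at hC'
    exact (ENNReal.mul_le_mul_iff_right hN0 hNtop).mp hC'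
  -- the real inequality behind `θ = 1/2`
  have hreal : C * (L / m) ^ 2 / (1 - 1 / 2) * (E + 1) ≤ 1 / 2 := by
    have hsq : (L / m) ^ 2 ≤ (2 * ℓ) ^ 2 := pow_le_pow_left₀ (by positivity) hsm 2
    have key : 16 * C * ℓ ^ 2 * (E + 1) ≤ 16 * ℓ ^ 2 * (C + 1) ^ 2 * (E + 1) ^ 2 := by
      have e1 : C ≤ (C + 1) ^ 2 := by nlinarith
      have e2 : E + 1 ≤ (E + 1) ^ 2 := by nlinarith
      calc 16 * C * ℓ ^ 2 * (E + 1) = 16 * ℓ ^ 2 * (C * (E + 1)) := by ring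
        _ ≤ 16 * ℓ ^ 2 * ((C + 1) ^ 2 * (E + 1) ^ 2) := by gcongr
        _ = 16 * ℓ ^ 2 * (C + 1) ^ 2 * (E + 1) ^ 2 := by ring
    have key2 : 16 * ℓ ^ 2 * (C + 1) ^ 2 * (E + 1) ^ 2 = 1 := by
      calc 16 * ℓ ^ 2 * (C + 1) ^ 2 * (E + 1) ^ 2 = (ℓ * (4 * (C + 1) * (E + 1))) ^ 2 := by ring
        _ = 1 := by rw [hu]; norm_num
    have h3' : C * (L / m) ^ 2 / (1 - 1 / 2) * (E + 1) = 2 * (E + 1) * C * (L / m) ^ 2 := by ring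
    rw [h3']
    calc 2 * (E + 1) * C * (L / m) ^ 2 ≤ 2 * (E + 1) * C * (2 * ℓ) ^ 2 :=
          mul_le_mul_of_nonneg_left hsq (by positivity)
      _ = (16 * C * ℓ ^ 2 * (E + 1)) / 2 := by ring
      _ ≤ 1 / 2 := by linarith [key, key2]
  have hpos' : (0 : ℝ) ≤ C * (L / m) ^ 2 / (1 - 1 / 2) := by
    rw [show (1 : ℝ) - 1 / 2 = 1 / 2 by norm_num]; positivity
  -- the chain
  have hmain := hbad n L m (1 / 2) Ψ hLpos hmpos (by norm_num) (by norm_num)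
  calc _ ≤ _ := hmain
    _ ≤ ENNReal.ofReal (C * (L / m) ^ 2 / (1 - 1 / 2)) * ENNReal.ofReal (E + 1) :=
        mul_le_mul_right hKle _
    _ = ENNReal.ofReal (C * (L / m) ^ 2 / (1 - 1 / 2) * (E + 1)) := (ENNReal.ofReal_mul hpos').symm
    _ ≤ ENNReal.ofReal (1 / 2) := ENNReal.ofReal_le_ofReal hreal

end Summit.AtomisticToContinuum.BoseEinsteinCondensation.Theorems
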